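import Summits.AtomisticToContinuum.BoseEinsteinCondensation.Theorems.BECPhaseQuadratureSumRuleSumRuleChainGlueBoxFourier
import Literature.MathematicalPhysics.QuantumManyBody.PeriodicBoseGasThm31
import HarnessLib

/-!
# Route `BECPhaseQuadratureSumRule`, glue `SumRuleChainGlue` (stmt-AtomisticToContinuum-12627) —
# helper: the long-wave structure factor from the sliding-box second moment (Bessel in `u`)

For a periodic trial state `Ψ` of `N` bosons on the torus of side `L`, boxes `Λ_ℓ(u)` with `0 < ℓ < L`, and a
finite set `S` of non-zero modes with `‖k_p‖ℓ ≤ 1`: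

  `N²ℓ⁶ + (25/64)ℓ⁶ Σ_{p∈S} ‖ρ_p†Ψ‖² ≤ L³ ∫_cell ∫ (Σⱼ Σ_m 1[xⱼ + Lm ∈ Λ_ℓ(u)])² |Ψ|² dX du`

(`density_sum_le_boxMoment`), where `‖ρ_p†Ψ‖² = ∫ |Σⱼ e_p(xⱼ)|²|Ψ|²` and the right-hand side is the quantity
bounded by the crux `LongWaveStructureBound`. With `N = ρL³` and that bound `(1+ε)(ρℓ³)²L³`, the `N²ℓ⁶`
terms cancel and `Σ_{p∈S} ‖ρ_p†Ψ‖² ≤ (64/25) ε N²` follows (in the glue). Mechanism, for a configuration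
`X ∈ cell^N`: the box count `u ↦ Σⱼ Σ_m 1[xⱼ + Lm ∈ Λ_ℓ(u)]` dominates the finite sum `g_X` of the indicators
of the boxes `Λ_ℓ(xⱼ - Ln)`, `n ∈ {-1,0,1}³`, whose cell Fourier coefficients are `conj(Σⱼ e_p(xⱼ)) · B_p`
(`B_p` the box integral of `conj e_p`, file `…BoxFourier`); Bessel's inequality on the cell, `B_0 = ℓ³` and
`|B_p| ≥ (5/8)ℓ³`.
-/

noncomputable section

open MeasureTheory Filter Set Complex
open scoped ENNReal NNReal Topology ComplexConjugate BigOperators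

namespace Summit.AtomisticToContinuum.BoseEinsteinCondensation.Theorems.SumRuleChainGlue

open Literature.MathematicalPhysics.QuantumManyBody.BoseGas

variable {N : ℕ} {L ℓ : ℝ}

/-- The nearest images `{-1, 0, 1}³ ⊂ ℤ³`. -/
theorem mem_nearImages_iff (n : Fin 3 → ℤ) :
    n ∈ Fintype.piFinset (fun _ : Fin 3 => ({-1, 0, 1} : Finset ℤ)) ↔ ∀ k, n k = -1 ∨ n k = 0 ∨ n k = 1 := by
  simp [Fintype.mem_piFinset]

/-- **Far images miss the cell**: for `x, u ∈ [0,L)³`, `ℓ < L` and `n ∉ {-1,0,1}³`, `u ∉ Λ_ℓ(x - Ln)`. -/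
theorem not_mem_slidingBox_of_far (hℓL : ℓ < L) {x u : Space} (hx : x ∈ cell L) (hu : u ∈ cell L)
    {n : Fin 3 → ℤ} (hn : n ∉ Fintype.piFinset (fun _ : Fin 3 => ({-1, 0, 1} : Finset ℤ))) :
    u ∉ slidingBox ℓ (x - latticeVec L n) := by
  rw [mem_nearImages_iff] at hn
  push Not at hn
  obtain ⟨k, hk1, hk0, hk2⟩ := hn
  intro hmem
  have h := hmem k
  simp only [PiLp.sub_apply, latticeVec_apply, Set.mem_Icc] at h
  have hxk := hx k
  have huk := hu k
  simp only [Set.mem_Ico] at hxk huk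
  have hL : 0 < L := lt_of_le_of_lt hxk.1 hxk.2
  have hn2 : (2 : ℤ) ≤ n k ∨ n k ≤ -2 := by omega
  rcases hn2 with h2 | h2
  · have h2' : (2 : ℝ) ≤ (n k : ℝ) := by exact_mod_cast h2
    have h3 : L * 2 ≤ L * (n k : ℝ) := mul_le_mul_of_nonneg_left h2' hL.le
    linarith [h.1, h.2, hxk.1, hxk.2, huk.1, huk.2]
  · have h2' : (n k : ℝ) ≤ -2 := by exact_mod_cast h2
    have h3 : L * (n k : ℝ) ≤ L * (-2) := mul_le_mul_of_nonneg_left h2' hL.le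
    linarith [h.1, h.2, hxk.1, hxk.2, huk.1, huk.2]

/-- The finite sum of near-image box indicators (a real-valued minorant of the crux's box count). -/
theorem boxMinorant_le (hL : L ≠ 0) (ℓ : ℝ) (X : Config N) (u : Space) :
    ENNReal.ofReal (∑ j : Fin N, ∑ n ∈ Fintype.piFinset (fun _ : Fin 3 => ({-1, 0, 1} : Finset ℤ)),
        (slidingBox ℓ (X j - latticeVec L n)).indicator (fun _ => (1 : ℝ)) u) ≤
      ∑ j : Fin N, ∑' m : Fin 3 → ℤ, (slidingBox ℓ u).indicator (fun _ => (1 : ℝ≥0∞)) (X j + latticeVec L m) := by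
  have _ := hL
  rw [ENNReal.ofReal_sum_of_nonneg fun j _ => Finset.sum_nonneg fun n _ => Set.indicator_nonneg (fun _ _ => zero_le_one) _]
  refine Finset.sum_le_sum fun j _ => ?_
  rw [ENNReal.ofReal_sum_of_nonneg fun n _ => Set.indicator_nonneg (fun _ _ => zero_le_one) _]
  have hterm : ∀ n, ENNReal.ofReal ((slidingBox ℓ (X j - latticeVec L n)).indicator (fun _ => (1 : ℝ)) u) ≤
      (slidingBox ℓ u).indicator (fun _ => (1 : ℝ≥0∞)) (X j + latticeVec L ((Equiv.neg (Fin 3 → ℤ)).toEmbedding n)) := by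
    intro n
    rw [Equiv.coe_toEmbedding, Equiv.neg_apply, latticeVec_neg, ← sub_eq_add_neg]
    by_cases h : u ∈ slidingBox ℓ (X j - latticeVec L n)
    · rw [Set.indicator_of_mem h, ENNReal.ofReal_one,
        Set.indicator_of_mem ((mem_slidingBox_comm ℓ u (X j - latticeVec L n)).2 h)]
    · rw [Set.indicator_of_notMem h, ENNReal.ofReal_zero]
      exact bot_le
  calc _ ≤ ∑ n ∈ Fintype.piFinset (fun _ : Fin 3 => ({-1, 0, 1} : Finset ℤ)),
          (fun m => (slidingBox ℓ u).indicator (fun _ => (1 : ℝ≥0∞)) (X j + latticeVec L m))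
            ((Equiv.neg (Fin 3 → ℤ)).toEmbedding n) :=
        Finset.sum_le_sum fun n _ => hterm n
    _ = ∑ m ∈ (Fintype.piFinset (fun _ : Fin 3 => ({-1, 0, 1} : Finset ℤ))).map (Equiv.neg (Fin 3 → ℤ)).toEmbedding,
          (slidingBox ℓ u).indicator (fun _ => (1 : ℝ≥0∞)) (X j + latticeVec L m) :=
        (Finset.sum_map (Fintype.piFinset (fun _ : Fin 3 => ({-1, 0, 1} : Finset ℤ))) (Equiv.neg (Fin 3 → ℤ)).toEmbedding
          (fun m => (slidingBox ℓ u).indicator (fun _ => (1 : ℝ≥0∞)) (X j + latticeVec L m))).symm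
    _ ≤ ∑' m, (slidingBox ℓ u).indicator (fun _ => (1 : ℝ≥0∞)) (X j + latticeVec L m) := ENNReal.sum_le_tsum _

/-- **The cell Fourier coefficients of the minorant**: for `X ∈ cell^N` and `ℓ < L`,
`∫_cell conj(e_p) g_X = conj(Σⱼ e_p(xⱼ)) · B_p`. -/
theorem setIntegral_conj_cellWave_boxMinorant (hL : 0 < L) (hℓL : ℓ < L) {X : Config N} (hX : X ∈ cellN N L)
    (p : Fin 3 → ℤ) :
    ∫ u in cell L, conj (cellWave L p u) * ((∑ j : Fin N, ∑ n ∈ Fintype.piFinset (fun _ : Fin 3 => ({-1, 0, 1} : Finset ℤ)),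
        (slidingBox ℓ (X j - latticeVec L n)).indicator (fun _ => (1 : ℝ)) u : ℝ) : ℂ) =
      conj (∑ j : Fin N, cellWave L p (X j)) * ∫ y in slidingBox ℓ 0, conj (cellWave L p y) := by
  set M := Fintype.piFinset (fun _ : Fin 3 => ({-1, 0, 1} : Finset ℤ)) with hM
  -- rewrite the integrand as a finite sum of box-indicators of `conj e_p`
  have hpt : ∀ u, conj (cellWave L p u) * ((∑ j : Fin N, ∑ n ∈ M,
      (slidingBox ℓ (X j - latticeVec L n)).indicator (fun _ => (1 : ℝ)) u : ℝ) : ℂ) =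
      ∑ j : Fin N, ∑ n ∈ M, (slidingBox ℓ (X j - latticeVec L n)).indicator (fun u => conj (cellWave L p u)) u := by
    intro u
    push_cast
    rw [Finset.mul_sum]
    refine Finset.sum_congr rfl fun j _ => ?_
    rw [Finset.mul_sum]
    refine Finset.sum_congr rfl fun n _ => ?_
    by_cases h : u ∈ slidingBox ℓ (X j - latticeVec L n)
    · rw [Set.indicator_of_mem h, Set.indicator_of_mem h]; push_cast; ring
    · rw [Set.indicator_of_notMem h, Set.indicator_of_notMem h]; push_cast; ring
  simp_rw [hpt]
  have hint : ∀ j n, IntegrableOn (fun u => (slidingBox ℓ (X j - latticeVec L n)).indicator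
      (fun u => conj (cellWave L p u)) u) (cell L) volume := fun j n =>
    (integrableOn_cell (Complex.continuous_conj.comp (continuous_cellWave L p))).indicator (measurableSet_slidingBox _ _)
  rw [integral_finsetSum _ fun j _ => integrable_finsetSum _ fun n _ => hint j n, map_sum, Finset.sum_mul]
  refine Finset.sum_congr rfl fun j _ => ?_
  rw [integral_finsetSum _ fun n _ => hint j n, ← tsum_setIntegral_conj_cellWave_box hL ℓ p (X j)]
  symm
  refine tsum_eq_sum fun n hn => ?_
  refine setIntegral_eq_zero_of_forall_eq_zero fun u hu => ?_
  exact Set.indicator_of_notMem (not_mem_slidingBox_of_far hℓL (hX j) hu hn) _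

/-- **Bessel for the minorant, per configuration**: for `X ∈ cell^N`, `ℓ < L`, a finite set `S` of non-zero modes
with `‖k_p‖ℓ ≤ 1`:
`N²ℓ⁶ + (25/64)ℓ⁶ Σ_{p∈S} |Σⱼ e_p(xⱼ)|² ≤ L³ ∫_cell g_X²`. -/
theorem density_sum_le_lintegral_config (hL : 0 < L) (hℓ : 0 ≤ ℓ) (hℓL : ℓ < L) {S : Finset (Fin 3 → ℤ)}
    (h0 : (0 : Fin 3 → ℤ) ∉ S) (hk : ∀ p ∈ S, ‖(2 * Real.pi / L) • latticeVec 1 p‖ * ℓ ≤ 1) {X : Config N}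
    (hX : X ∈ cellN N L) :
    (N : ℝ) ^ 2 * ℓ ^ 6 + 25 / 64 * ℓ ^ 6 * ∑ p ∈ S, ‖∑ j : Fin N, cellWave L p (X j)‖ ^ 2 ≤
      L ^ 3 * ∫ u in cell L, (∑ j : Fin N, ∑ n ∈ Fintype.piFinset (fun _ : Fin 3 => ({-1, 0, 1} : Finset ℤ)),
        (slidingBox ℓ (X j - latticeVec L n)).indicator (fun _ => (1 : ℝ)) u) ^ 2 := by
  classical
  set M := Fintype.piFinset (fun _ : Fin 3 => ({-1, 0, 1} : Finset ℤ)) with hM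
  set g : Space → ℝ := fun u => ∑ j : Fin N, ∑ n ∈ M, (slidingBox ℓ (X j - latticeVec L n)).indicator (fun _ => (1 : ℝ)) u
    with hg
  -- `g` is measurable and bounded
  have hgm : Measurable g := by
    refine Finset.measurable_sum _ fun j _ => Finset.measurable_sum _ fun n _ => ?_
    exact measurable_const.indicator (measurableSet_slidingBox _ _)
  have hg0 : ∀ u, 0 ≤ g u := fun u =>
    Finset.sum_nonneg fun j _ => Finset.sum_nonneg fun n _ => Set.indicator_nonneg (fun _ _ => zero_le_one) _
  have hgC : ∀ u, ‖(g u : ℂ)‖ ≤ N * M.card := by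
    intro u
    rw [Complex.norm_real, Real.norm_of_nonneg (hg0 u), hg]
    calc ∑ j : Fin N, ∑ n ∈ M, (slidingBox ℓ (X j - latticeVec L n)).indicator (fun _ => (1 : ℝ)) u
        ≤ ∑ _j : Fin N, ∑ _n ∈ M, (1 : ℝ) := Finset.sum_le_sum fun j _ => Finset.sum_le_sum fun n _ =>
          Set.indicator_le_self' (fun _ _ => zero_le_one) _
      _ = N * M.card := by simp
  -- Bessel on `insert 0 S`
  have hB := bessel_cell hL (g := fun u => (g u : ℂ)) (Complex.continuous_ofReal.measurable.comp hgm).aestronglyMeasurable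
    hgC (insert 0 S)
  rw [Finset.sum_insert h0] at hB
  -- the coefficients
  have hcoef : ∀ p, ∫ u in cell L, conj (cellWave L p u) * (g u : ℂ) =
      conj (∑ j : Fin N, cellWave L p (X j)) * ∫ y in slidingBox ℓ 0, conj (cellWave L p y) := fun p =>
    setIntegral_conj_cellWave_boxMinorant hL hℓL hX p
  simp only [hcoef, norm_mul, Complex.norm_conj, mul_pow] at hB
  -- the zero mode
  have hzero : ‖∑ j : Fin N, cellWave L 0 (X j)‖ ^ 2 * ‖∫ y in slidingBox ℓ 0, conj (cellWave L 0 y)‖ ^ 2 =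
      (N : ℝ) ^ 2 * ℓ ^ 6 := by
    rw [boxCoeff_zero hℓ L]
    simp only [cellWave_zero, Finset.sum_const, Finset.card_univ, Fintype.card_fin, nsmul_eq_mul, mul_one]
    rw [Complex.norm_natCast, Complex.norm_real, Real.norm_of_nonneg (by positivity)]
    ring
  rw [hzero] at hB
  -- the norm of `g` is the real integral of `g²`
  have hnorm : ∫ u in cell L, ‖(g u : ℂ)‖ ^ 2 = ∫ u in cell L, g u ^ 2 := by
    refine integral_congr_ae (Eventually.of_forall fun u => ?_)
    show ‖((g u : ℝ) : ℂ)‖ ^ 2 = g u ^ 2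
    rw [Complex.norm_real, Real.norm_eq_abs, sq_abs]
  rw [hnorm] at hB
  -- the long modes
  have hlong : 25 / 64 * ℓ ^ 6 * ∑ p ∈ S, ‖∑ j : Fin N, cellWave L p (X j)‖ ^ 2 ≤
      ∑ p ∈ S, ‖∑ j : Fin N, cellWave L p (X j)‖ ^ 2 * ‖∫ y in slidingBox ℓ 0, conj (cellWave L p y)‖ ^ 2 := by
    rw [Finset.mul_sum]
    refine Finset.sum_le_sum fun p hp => ?_
    have h58 := norm_boxCoeff_ge hℓ L p (hk p hp)
    have h58' : 25 / 64 * ℓ ^ 6 ≤ ‖∫ y in slidingBox ℓ 0, conj (cellWave L p y)‖ ^ 2 := by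
      have h0' : 0 ≤ 5 / 8 * ℓ ^ 3 := by positivity
      nlinarith [h58, h0']
    calc 25 / 64 * ℓ ^ 6 * ‖∑ j : Fin N, cellWave L p (X j)‖ ^ 2
        = ‖∑ j : Fin N, cellWave L p (X j)‖ ^ 2 * (25 / 64 * ℓ ^ 6) := by ring
      _ ≤ _ := mul_le_mul_of_nonneg_left h58' (sq_nonneg _)
  linarith

/-- Joint measurability of the box count (as in the crux). -/
theorem measurable_boxCount' (ℓ L : ℝ) :
    Measurable fun q : Space × Config N => ∑ j : Fin N, ∑' m : Fin 3 → ℤ,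
      (slidingBox ℓ q.1).indicator (fun _ => (1 : ℝ≥0∞)) (q.2 j + latticeVec L m) := by
  refine Finset.measurable_sum _ fun j _ => Measurable.tsum fun m => ?_
  have hset : MeasurableSet {q : Space × Config N | q.2 j + latticeVec L m ∈ slidingBox ℓ q.1} := by
    have : {q : Space × Config N | q.2 j + latticeVec L m ∈ slidingBox ℓ q.1} =
        (fun q : Space × Config N => q.2 j + latticeVec L m - q.1) ⁻¹' slidingBox ℓ 0 := by
      ext q
      simp only [Set.mem_setOf_eq, Set.mem_preimage, mem_slidingBox_iff_sub ℓ q.1]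
    rw [this]
    exact (measurableSet_slidingBox ℓ 0).preimage
      ((((measurable_pi_apply j).comp measurable_snd).add_const _).sub measurable_fst)
  have : (fun q : Space × Config N => (slidingBox ℓ q.1).indicator (fun _ => (1 : ℝ≥0∞)) (q.2 j + latticeVec L m)) =
      {q : Space × Config N | q.2 j + latticeVec L m ∈ slidingBox ℓ q.1}.indicator fun _ => (1 : ℝ≥0∞) := by
    funext q
    by_cases h : q.2 j + latticeVec L m ∈ slidingBox ℓ q.1
    · rw [Set.indicator_of_mem h,
        Set.indicator_of_mem (show q ∈ {q : Space × Config N | q.2 j + latticeVec L m ∈ slidingBox ℓ q.1} from h)]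
    · rw [Set.indicator_of_notMem h,
        Set.indicator_of_notMem (show q ∉ {q : Space × Config N | q.2 j + latticeVec L m ∈ slidingBox ℓ q.1} from h)]
  rw [this]
  exact measurable_const.indicator hset

/-- **The long-wave structure factor from the sliding-box second moment.** For `0 ≤ ℓ < L`, a finite set `S`
of non-zero modes with `‖k_p‖ℓ ≤ 1` and a periodic trial state `Ψ`:
`N²ℓ⁶ + (25/64)ℓ⁶ Σ_{p∈S} ‖ρ_p†Ψ‖² ≤ L³ ∫_cell ∫ (Σⱼ Σ_m 1[xⱼ + Lm ∈ Λ_ℓ(u)])² |Ψ|² dX du`. -/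
theorem density_sum_le_boxMoment (hL : 0 < L) (hℓ : 0 ≤ ℓ) (hℓL : ℓ < L) {S : Finset (Fin 3 → ℤ)}
    (h0 : (0 : Fin 3 → ℤ) ∉ S) (hk : ∀ p ∈ S, ‖(2 * Real.pi / L) • latticeVec 1 p‖ * ℓ ≤ 1)
    (Ψ : PeriodicTrialState N L) :
    ENNReal.ofReal ((N : ℝ) ^ 2 * ℓ ^ 6) + ENNReal.ofReal (25 / 64 * ℓ ^ 6) *
        ∑ p ∈ S, ∫⁻ X in cellN N L, (‖∑ j : Fin N, cellWave L p (X j) * Ψ.ψ X‖₊ : ℝ≥0∞) ^ 2 ≤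
      ENNReal.ofReal (L ^ 3) * ∫⁻ u in cell L, ∫⁻ X in cellN N L, (∑ j : Fin N, ∑' m : Fin 3 → ℤ,
        (slidingBox ℓ u).indicator (fun _ => (1 : ℝ≥0∞)) (X j + latticeVec L m)) ^ 2 * (‖Ψ.ψ X‖₊ : ℝ≥0∞) ^ 2 := by
  classical
  set M := Fintype.piFinset (fun _ : Fin 3 => ({-1, 0, 1} : Finset ℤ)) with hM
  set G : Space → Config N → ℝ≥0∞ := fun u X => ∑ j : Fin N, ∑' m : Fin 3 → ℤ,
    (slidingBox ℓ u).indicator (fun _ => (1 : ℝ≥0∞)) (X j + latticeVec L m) with hG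
  set g : Config N → Space → ℝ := fun X u => ∑ j : Fin N, ∑ n ∈ M,
    (slidingBox ℓ (X j - latticeVec L n)).indicator (fun _ => (1 : ℝ)) u with hg
  -- Tonelli: integrate over `u` first
  have hF : Measurable fun q : Space × Config N => G q.1 q.2 ^ 2 * (‖Ψ.ψ q.2‖₊ : ℝ≥0∞) ^ 2 :=
    ((measurable_boxCount' ℓ L).pow_const 2).mul (Ψ.measurable_normSq.comp measurable_snd)
  have hswap : ∫⁻ u in cell L, ∫⁻ X in cellN N L, G u X ^ 2 * (‖Ψ.ψ X‖₊ : ℝ≥0∞) ^ 2 =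
      ∫⁻ X in cellN N L, (∫⁻ u in cell L, G u X ^ 2) * (‖Ψ.ψ X‖₊ : ℝ≥0∞) ^ 2 := by
    rw [lintegral_lintegral_swap (hF.aemeasurable (μ := (volume.restrict (cell L)).prod (volume.restrict (cellN N L))))]
    refine lintegral_congr fun X => ?_
    rw [lintegral_mul_const' _ _ (ENNReal.pow_ne_top ENNReal.coe_ne_top)]
  show _ ≤ ENNReal.ofReal (L ^ 3) * ∫⁻ u in cell L, ∫⁻ X in cellN N L, G u X ^ 2 * (‖Ψ.ψ X‖₊ : ℝ≥0∞) ^ 2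
  rw [hswap, ← lintegral_const_mul' _ _ ENNReal.ofReal_ne_top]
  -- the left-hand side as one integral over `cell^N`
  have hmeas : ∀ p, Measurable fun X : Config N => (‖∑ j : Fin N, cellWave L p (X j) * Ψ.ψ X‖₊ : ℝ≥0∞) ^ 2 := fun p =>
    ((Finset.measurable_sum _ fun j _ => ((continuous_cellWave L p).measurable.comp (measurable_pi_apply j)).mul
      Ψ.contDiff.continuous.measurable).nnnorm.coe_nnreal_ennreal).pow_const _
  have hlhs : ENNReal.ofReal ((N : ℝ) ^ 2 * ℓ ^ 6) + ENNReal.ofReal (25 / 64 * ℓ ^ 6) *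
      ∑ p ∈ S, ∫⁻ X in cellN N L, (‖∑ j : Fin N, cellWave L p (X j) * Ψ.ψ X‖₊ : ℝ≥0∞) ^ 2 =
      ∫⁻ X in cellN N L, ENNReal.ofReal ((N : ℝ) ^ 2 * ℓ ^ 6 + 25 / 64 * ℓ ^ 6 *
        ∑ p ∈ S, ‖∑ j : Fin N, cellWave L p (X j)‖ ^ 2) * (‖Ψ.ψ X‖₊ : ℝ≥0∞) ^ 2 := by
    have hsplit : ∀ X : Config N, ENNReal.ofReal ((N : ℝ) ^ 2 * ℓ ^ 6 + 25 / 64 * ℓ ^ 6 *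
        ∑ p ∈ S, ‖∑ j : Fin N, cellWave L p (X j)‖ ^ 2) * (‖Ψ.ψ X‖₊ : ℝ≥0∞) ^ 2 =
        ENNReal.ofReal ((N : ℝ) ^ 2 * ℓ ^ 6) * (‖Ψ.ψ X‖₊ : ℝ≥0∞) ^ 2 + ENNReal.ofReal (25 / 64 * ℓ ^ 6) *
          ∑ p ∈ S, (‖∑ j : Fin N, cellWave L p (X j) * Ψ.ψ X‖₊ : ℝ≥0∞) ^ 2 := by
      intro X
      rw [ENNReal.ofReal_add (by positivity) (by positivity), add_mul,
        ENNReal.ofReal_mul (p := 25 / 64 * ℓ ^ 6) (by positivity),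
        ENNReal.ofReal_sum_of_nonneg (fun p _ => by positivity), mul_assoc, Finset.sum_mul]
      congr 2
      refine Finset.sum_congr rfl fun p _ => ?_
      rw [← Finset.sum_mul, nnnorm_mul, ENNReal.coe_mul, mul_pow]
      simp only [coe_nnnorm_sq_eq_ofReal]
    simp_rw [hsplit]
    have hm1 : Measurable fun X : Config N => ENNReal.ofReal ((N : ℝ) ^ 2 * ℓ ^ 6) * (‖Ψ.ψ X‖₊ : ℝ≥0∞) ^ 2 :=
      Ψ.measurable_normSq.const_mul _
    rw [lintegral_add_left hm1, lintegral_const_mul _ Ψ.measurable_normSq, Ψ.norm_eq, mul_one,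
      lintegral_const_mul _ (Finset.measurable_sum _ fun p _ => hmeas p), lintegral_finsetSum _ fun p _ => hmeas p]
  rw [hlhs, ← lintegral_indicator (measurableSet_cellN N L), ← lintegral_indicator (measurableSet_cellN N L)]
  refine lintegral_mono fun X => ?_
  by_cases hX : X ∈ cellN N L
  · rw [Set.indicator_of_mem hX, Set.indicator_of_mem hX, ← mul_assoc]
    refine mul_le_mul_of_nonneg_right ?_ bot_le
    -- the per-configuration inequality, moved to `ℝ≥0∞`
    have hreal := density_sum_le_lintegral_config hL hℓ hℓL h0 hk hX
    have hg0 : ∀ u, 0 ≤ g X u := fun u =>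
      Finset.sum_nonneg fun j _ => Finset.sum_nonneg fun n _ => Set.indicator_nonneg (fun _ _ => zero_le_one) _
    have hgm : Measurable (g X) := by
      refine Finset.measurable_sum _ fun j _ => Finset.measurable_sum _ fun n _ => ?_
      exact measurable_const.indicator (measurableSet_slidingBox _ _)
    have hgb : ∀ u, g X u ^ 2 ≤ ((N : ℝ) * M.card) ^ 2 := by
      intro u
      refine pow_le_pow_left₀ (hg0 u) ?_ 2
      calc g X u ≤ ∑ _j : Fin N, ∑ _n ∈ M, (1 : ℝ) := Finset.sum_le_sum fun j _ => Finset.sum_le_sum fun n _ =>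
            Set.indicator_le_self' (fun _ _ => zero_le_one) _
        _ = N * M.card := by simp
    have hgi : IntegrableOn (fun u => g X u ^ 2) (cell L) volume := by
      refine Measure.integrableOn_of_bounded (M := ((N : ℝ) * M.card) ^ 2) ?_ (hgm.pow_const 2).aestronglyMeasurable
        (Eventually.of_forall fun u => ?_)
      · rw [volume_cell]; exact ENNReal.pow_ne_top ENNReal.ofReal_ne_top
      · rw [Real.norm_of_nonneg (sq_nonneg _)]; exact hgb u
    calc ENNReal.ofReal ((N : ℝ) ^ 2 * ℓ ^ 6 + 25 / 64 * ℓ ^ 6 * ∑ p ∈ S, ‖∑ j : Fin N, cellWave L p (X j)‖ ^ 2)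
        ≤ ENNReal.ofReal (L ^ 3 * ∫ u in cell L, g X u ^ 2) := ENNReal.ofReal_le_ofReal hreal
      _ = ENNReal.ofReal (L ^ 3) * ∫⁻ u in cell L, ENNReal.ofReal (g X u ^ 2) := by
          rw [ENNReal.ofReal_mul (by positivity), ofReal_integral_eq_lintegral_ofReal hgi
            (Eventually.of_forall fun u => sq_nonneg _)]
      _ ≤ ENNReal.ofReal (L ^ 3) * ∫⁻ u in cell L, G u X ^ 2 := by
          refine mul_le_mul_of_nonneg_left (lintegral_mono fun u => ?_) bot_le
          rw [ENNReal.ofReal_pow (hg0 u)]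
          exact pow_le_pow_left₀ bot_le (boxMinorant_le hL.ne' ℓ X u) 2
  · rw [Set.indicator_of_notMem hX, Set.indicator_of_notMem hX]

end Summit.AtomisticToContinuum.BoseEinsteinCondensation.Theorems.SumRuleChainGlue

end
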